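import Literature.NumberTheory.Automorphic.LanglandsParameters
import Literature.NumberTheory.Automorphic.LParameterGLComponentGroupProofs
import Mathlib.Topology.Algebra.Group.ClosedSubgroup
import HarnessLib

/-!
# Discharge of `isDiscrete_iff_of_gl`: an L-parameter of `GL_n` is discrete iff its centralizer
# is the centre

D-0014 keeps `Literature/` sorry-free by stating cited results as named facts `def X : Prop`.
This sibling file of `Literature.NumberTheory.Automorphic.LanglandsParameters` proves its named
fact `isDiscrete_iff_of_gl F n` (lang.S14; Gross–Reeder 2010, §3.2; Kaletha 2016, §5.1; Borel,
Corvallis 1979, §10.3(3)): for every L-parameter `φ` of `LGroupData.gl F n` (`Ĝ = GL_n(ℂ)`,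
trivial Galois action), `φ` is *discrete* — `S_φ / Z(Ĝ)^Γ` is finite — iff `S_φ = Z(Ĝ)^Γ`.

The printed argument: "`S_φ` is a connected product of general linear groups containing the
scalars, so `S_φ / ℂˣ` is finite only if it is trivial."  Formalisation: `S_φ` is path-connected
(`LParameter.pathConnectedSpace_centralizerGroup_gl`, the complex-line argument of
`LParameterGLComponentGroupProofs.lean`); `Z(Ĝ)^Γ ≤ S_φ` (`centerFixed_le_centralizerGroup`) is,
for the trivial Galois action, the centre of `Ĝ`, which is closed (`GL_n(ℂ)` is Hausdorff); a
closed subgroup of finite index of a topological group is open (Mathlib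
`Subgroup.isOpen_of_isClosed_of_finiteIndex`), and a non-empty clopen subset of a connected space
is everything.  Conversely if `S_φ = Z(Ĝ)^Γ` the quotient is a point.

## References

* B. Gross, M. Reeder, *Arithmetic invariants of discrete Langlands parameters*, Duke Math. J.
  154 (2010), §3.2. [GrossReeder2010]
* T. Kaletha, *The local Langlands conjectures for non-quasi-split groups* (2016), §5.1.
  [Kaletha2016]
* A. Borel, *Automorphic L-functions*, Proc. Sympos. Pure Math. 33 (Corvallis 1979), Part 2,
  §10.3(3). [Corvallis1979]
-/

noncomputable section

open scoped MatrixGroups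
open Topology Set

namespace Literature.NumberTheory.Automorphic

namespace LParameter

section Split

variable {F : Type*} [Field F] {n : ℕ}

/-- For `LGroupData.gl F n` (trivial Galois action) the Galois-fixed centre `Z(Ĝ)^Γ` is the
centre of `Ĝ = GL_n(ℂ)`.  Ref: Borel, Corvallis 1979, §2.4. [folklore] -/
private theorem mem_centerFixed_gl_iff (g : (LGroupData.gl F n).dual) :
    g ∈ (LGroupData.gl F n).centerFixed ↔ g ∈ Subgroup.center (LGroupData.gl F n).dual := by
  have hga : (LGroupData.gl F n).galAct = 1 := LGroupData.isSplit_gl n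
  rw [LGroupData.mem_centerFixed_iff, hga]
  simp

/-- The Galois-fixed centre of `Ĝ = GL_n(ℂ)` is closed (the centre of a Hausdorff topological
group is an intersection of equalisers). [folklore] -/
private theorem isClosed_centerFixed_gl :
    IsClosed ((LGroupData.gl F n).centerFixed : Set (LGroupData.gl F n).dual) := by
  have e : ((LGroupData.gl F n).centerFixed : Set (LGroupData.gl F n).dual) =
      ⋂ h : (LGroupData.gl F n).dual, {g | h * g = g * h} := by
    ext g
    rw [SetLike.mem_coe, mem_centerFixed_gl_iff, Subgroup.mem_center_iff, Set.mem_iInter]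
    simp only [Set.mem_setOf_eq]
  rw [e]
  exact isClosed_iInter fun h =>
    isClosed_eq (continuous_const.mul continuous_id) (continuous_id.mul continuous_const)

end Split

variable {F : Type*} [Field F] [ValuativeRel F] [TopologicalSpace F] [IsNonarchimedeanLocalField F]
variable {n : ℕ}

/-- **For `GL_n`, a finite-index `Z(Ĝ)^Γ` inside `S_φ` is all of `S_φ`**: `S_φ` is path-connected
(`pathConnectedSpace_centralizerGroup_gl`) and `Z(Ĝ)^Γ ∩ S_φ` is a closed subgroup, so if it has
finite index it is open (`Subgroup.isOpen_of_isClosed_of_finiteIndex`), hence clopen, hence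
everything.  Ref: Gross–Reeder, Duke Math. J. 154 (2010), §3.2; Kaletha (2016), §5.1.
[cite: Kaletha2016, §5.1] -/
theorem centralizerGroup_eq_centerFixed_of_isDiscrete_gl (φ : LParameter (LGroupData.gl F n))
    (h : φ.IsDiscrete) : φ.centralizerGroup = (LGroupData.gl F n).centerFixed := by
  haveI : PathConnectedSpace φ.centralizerGroup := pathConnectedSpace_centralizerGroup_gl φ
  set Z : Subgroup φ.centralizerGroup :=
    (LGroupData.gl F n).centerFixed.subgroupOf φ.centralizerGroup with hZ
  haveI : Finite (φ.centralizerGroup ⧸ Z) := h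
  haveI : Z.FiniteIndex := Subgroup.finiteIndex_of_finite_quotient
  have hZc : IsClosed (Z : Set φ.centralizerGroup) :=
    isClosed_centerFixed_gl.preimage continuous_subtype_val
  have hZo : IsOpen (Z : Set φ.centralizerGroup) := Subgroup.isOpen_of_isClosed_of_finiteIndex Z hZc
  have hZtop : (Z : Set φ.centralizerGroup) = Set.univ :=
    (IsClopen.eq_univ ⟨hZc, hZo⟩ ⟨1, Z.one_mem⟩)
  refine le_antisymm (fun g hg => ?_) (centerFixed_le_centralizerGroup φ)
  have hmem : (⟨g, hg⟩ : φ.centralizerGroup) ∈ (Z : Set φ.centralizerGroup) := by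
    rw [hZtop]; exact Set.mem_univ _
  exact Subgroup.mem_subgroupOf.mp hmem

end LParameter

section Holds

variable {F : Type*} [Field F] [ValuativeRel F] [TopologicalSpace F] [IsNonarchimedeanLocalField F]

variable (F) in
/-- **Discharge of `isDiscrete_iff_of_gl`** (lang.S14): for `GL_n`, an L-parameter `φ` is discrete
(`S_φ / Z(Ĝ)^Γ` finite) iff `S_φ = Z(Ĝ)^Γ` — "`S_φ` is a connected product of general linear
groups containing the scalars, so `S_φ / ℂˣ` is finite only if it is trivial".  Forward direction
`centralizerGroup_eq_centerFixed_of_isDiscrete_gl` (connectedness of `S_φ`); backward: the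
quotient of `S_φ` by all of itself is a point.
Ref: Gross–Reeder, Duke Math. J. 154 (2010), §3.2; Kaletha (2016), §5.1; Borel, Corvallis 1979,
§10.3(3). [cite: Kaletha2016, §5.1] [cite: GrossReeder2010, §3.2] -/
theorem isDiscrete_iff_of_gl_holds (n : ℕ) : isDiscrete_iff_of_gl F n := by
  intro φ
  constructor
  · exact LParameter.centralizerGroup_eq_centerFixed_of_isDiscrete_gl φ
  · intro h
    change Finite (φ.centralizerGroup ⧸ (LGroupData.gl F n).centerFixed.subgroupOf φ.centralizerGroup)
    have htop : (LGroupData.gl F n).centerFixed.subgroupOf φ.centralizerGroup = ⊤ := by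
      rw [Subgroup.subgroupOf_eq_top]
      exact h.le
    rw [htop]
    haveI : Subsingleton (φ.centralizerGroup ⧸ (⊤ : Subgroup φ.centralizerGroup)) :=
      QuotientGroup.subsingleton_quotient_top
    infer_instance

end Holds

end Literature.NumberTheory.Automorphic

end
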